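import Summits.QuantumFields.YangMills.Theorems.LuscherReductionTwistedTraceScalingMehlerTensorGap
import HarnessLib

/-!
# C4 INNER, brick O (part 3): the BORN–OPPENHEIMER PROJECTION `P` and the three blocks of the MODEL kernel `k(c,c')·K(q,q')`
# (lane A of S-BASE, crux `TwistedTraceScaling` stmt-QuantumFields-20203; sub-target C4, design note `pub/ym-fleet/ym-luscher-20007-p1/COARSE-DESIGN.md` §21.3/§21.5 O)

The Feshbach package `InnerBOPackageAt` (`…InnerBOPackage`) splits an inner test function into `PΦ` (one-site function of the slow coordinate ⊗ stiff ground state) and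
`Φ − PΦ`.  For the MODEL kernel (the lattice kernel in the product chart is this up to a pointwise factor `1 ± η`, `…InnerKernelComparison`) the three blocks are exact
consequences of the tensor gap ★★★ `abs_tensorForm_sub_slow_le` (`…MehlerTensorGap`):
* §1 `boProj Φ (c,q) = slowCoeff Φ c · hR 0 q`, `boOrth Φ = Φ − boProj Φ`; `MemLp`; `slowCoeff (boProj Φ) = slowCoeff Φ`, `orthSq (boProj Φ) = 0`; a.e.
  `slowCoeff (boOrth Φ) = 0`, `orthSq (boOrth Φ) = fibreSq (boOrth Φ)`; the fibrewise Pythagoras `‖Φ‖² = ‖slowCoeff Φ‖²_{L²(C)} + ‖boOrth Φ‖²`;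
* §2 ★★ DIAGONAL `T(PΦ, PΨ) = λ₀ ∫∫ φ₀ k ψ₀` (the slow = one-site form, EXACTLY), ★★ OFF-DIAGONAL `T(PΦ, Ψ − PΨ) = 0`, ★★ STIFF
  `T(Φ − PΦ, Φ − PΦ) ≤ λ₀ρμ₁ ‖Φ − PΦ‖²`.
HONEST FRAMING: measure-theoretic bookkeeping for a stub of a child of the CONDITIONAL reduction route (femto rung R2b1); not infinite volume, not a gap, not Clay.

## References
* M. Lüscher, Nucl. Phys. B219 (1983) 233, §3 (projection onto the ground state of the non-constant modes). [Luscher1983]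
-/

set_option autoImplicit false

open MeasureTheory Filter Topology
open scoped Real

namespace Summit.QuantumFields.YangMills.Theorems.FemtoTransferGap.Mehler

open Literature.Analysis.SegalBargmann Literature.Analysis.OperatorTheory

noncomputable section

variable {C : Type*} [MeasurableSpace C] {ν : Measure C} [SFinite ν]
variable {σ : Type*} [Fintype σ] [DecidableEq σ]

/-! ### §1 The Born–Oppenheimer projection -/

/-- **The BO projection** `(PΦ)(c,q) = φ₀(c) · hR 0 (q)`. [cite: Luscher1983, §3] -/
def boProj (Φ : C × (σ → ℝ) → ℝ) : C × (σ → ℝ) → ℝ := fun x => slowCoeff Φ x.1 * hR (0 : σ →₀ ℕ) x.2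

/-- Its complement `Φ − PΦ`. [cite: Luscher1983, §3] -/
def boOrth (Φ : C × (σ → ℝ) → ℝ) : C × (σ → ℝ) → ℝ := Φ - boProj Φ

omit [SFinite ν] [DecidableEq σ] in
/-- A product `g(c)·h(q)` of `L²` functions is in `L²(C × ℝ^σ)`. [folklore] -/
theorem memLp_prod_mul {g : C → ℝ} {h : (σ → ℝ) → ℝ} (hg : MemLp g 2 ν) (hh : MemLp h 2 (volume : Measure (σ → ℝ))) :
    MemLp (fun x : C × (σ → ℝ) => g x.1 * h x.2) 2 (ν.prod volume) := by
  have hm : AEStronglyMeasurable (fun x : C × (σ → ℝ) => g x.1 * h x.2) (ν.prod volume) := hg.aestronglyMeasurable.comp_fst.mul hh.aestronglyMeasurable.comp_snd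
  rw [memLp_two_iff_integrable_sq hm]
  have := hg.integrable_sq.mul_prod hh.integrable_sq
  exact this.congr (ae_of_all _ fun x => by ring)

/-- `PΦ ∈ L²`. [folklore] -/
theorem memLp_boProj {Φ : C × (σ → ℝ) → ℝ} (hΦ : MemLp Φ 2 (ν.prod volume)) : MemLp (boProj Φ) 2 (ν.prod volume) :=
  memLp_prod_mul (memLp_slowCoeff hΦ) (memLp_hR 0)

/-- `Φ − PΦ ∈ L²`. [folklore] -/
theorem memLp_boOrth {Φ : C × (σ → ℝ) → ℝ} (hΦ : MemLp Φ 2 (ν.prod volume)) : MemLp (boOrth Φ) 2 (ν.prod volume) :=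
  hΦ.sub (memLp_boProj hΦ)

omit [MeasurableSpace C] [SFinite ν] in
/-- The slow coefficient of a product `g ⊗ hR 0` is `g`. [cite: Folland1989, §1.7 (vii)] -/
theorem slowCoeff_prod_hR (g : C → ℝ) (c : C) : slowCoeff (fun x : C × (σ → ℝ) => g x.1 * hR (0 : σ →₀ ℕ) x.2) c = g c := by
  show ∫ q, g c * hR (0 : σ →₀ ℕ) q * hR (0 : σ →₀ ℕ) q = g c
  have e : (fun q : σ → ℝ => g c * hR (0 : σ →₀ ℕ) q * hR 0 q) = fun q => g c * (hR (0 : σ →₀ ℕ) q * hR 0 q) := by funext q; ring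
  rw [e, integral_const_mul, integral_hR_mul_hR, if_pos rfl, mul_one]

omit [MeasurableSpace C] [SFinite ν] in
/-- The fibre norm² of a product `g ⊗ hR 0` is `g²`. [cite: Folland1989, §1.7 (vii)] -/
theorem fibreSq_prod_hR (g : C → ℝ) (c : C) : fibreSq (fun x : C × (σ → ℝ) => g x.1 * hR (0 : σ →₀ ℕ) x.2) c = g c ^ 2 := by
  show ∫ q, (g c * hR (0 : σ →₀ ℕ) q) ^ 2 = g c ^ 2
  have e : (fun q : σ → ℝ => (g c * hR (0 : σ →₀ ℕ) q) ^ 2) = fun q => g c ^ 2 * (hR (0 : σ →₀ ℕ) q * hR 0 q) := by funext q; ring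
  rw [e, integral_const_mul, integral_hR_mul_hR, if_pos rfl, mul_one]

omit [MeasurableSpace C] [SFinite ν] in
/-- `slowCoeff (PΦ) = slowCoeff Φ`, `orthSq (PΦ) = 0`. [cite: Luscher1983, §3] -/
theorem slowCoeff_boProj (Φ : C × (σ → ℝ) → ℝ) (c : C) : slowCoeff (boProj Φ) c = slowCoeff Φ c ∧ orthSq (boProj Φ) c = 0 := by
  have h1 : slowCoeff (boProj Φ) c = slowCoeff Φ c := slowCoeff_prod_hR (slowCoeff Φ) c
  have h2 : fibreSq (boProj Φ) c = slowCoeff Φ c ^ 2 := fibreSq_prod_hR (slowCoeff Φ) c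
  refine ⟨h1, ?_⟩
  unfold orthSq
  rw [h1, h2, sub_self]

/-- A.e.: `slowCoeff (Φ − PΦ) = 0` and `orthSq (Φ − PΦ) = fibreSq (Φ − PΦ) = orthSq Φ`. [cite: Luscher1983, §3] -/
theorem ae_slowCoeff_boOrth {Φ : C × (σ → ℝ) → ℝ} (hΦ : MemLp Φ 2 (ν.prod volume)) :
    ∀ᵐ c ∂ν, slowCoeff (boOrth Φ) c = 0 ∧ orthSq (boOrth Φ) c = fibreSq (boOrth Φ) c ∧ fibreSq (boOrth Φ) c = orthSq Φ c := by
  filter_upwards [ae_memLp_fibre hΦ] with c hc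
  -- on this fibre `boOrth Φ (c,·) = orthPart (Φ(c,·))`
  have e : (fun q => boOrth Φ (c, q)) = orthPart (fun q => Φ (c, q)) := by
    funext q; simp [boOrth, boProj, orthPart, slowCoeff, hermCoeff]
  have h1 : slowCoeff (boOrth Φ) c = 0 := by
    have := hermCoeff_orthPart_zero hc
    rw [← e] at this
    exact this
  have h3 : fibreSq (boOrth Φ) c = orthSq Φ c := by
    have := integral_orthPart_sq hc
    rw [← e] at this
    exact this
  refine ⟨h1, ?_, h3⟩
  rw [orthSq, h1]; ring

/-- ★ Fibrewise Pythagoras integrated: `‖Φ‖² = ∫ slowCoeff Φ² + ‖Φ − PΦ‖²`, and `∫ orthSq (Φ − PΦ) = ‖Φ − PΦ‖²`, `∫ orthSq Φ = ‖Φ − PΦ‖²`. [cite: Luscher1983, §3] -/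
theorem integral_sq_eq_slow_add_orth {Φ : C × (σ → ℝ) → ℝ} (hΦ : MemLp Φ 2 (ν.prod volume)) :
    ∫ c, orthSq (boOrth Φ) c ∂ν = ∫ x, boOrth Φ x ^ 2 ∂(ν.prod volume) ∧ ∫ c, orthSq Φ c ∂ν = ∫ x, boOrth Φ x ^ 2 ∂(ν.prod volume) ∧
      ∫ x, Φ x ^ 2 ∂(ν.prod volume) = (∫ c, slowCoeff Φ c ^ 2 ∂ν) + ∫ x, boOrth Φ x ^ 2 ∂(ν.prod volume) := by
  have hO := memLp_boOrth hΦ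
  obtain ⟨_, hfo⟩ := integrable_fibreSq hO
  obtain ⟨hfi, hf⟩ := integrable_fibreSq hΦ
  have hae := ae_slowCoeff_boOrth hΦ
  have h1 : ∫ c, orthSq (boOrth Φ) c ∂ν = ∫ c, fibreSq (boOrth Φ) c ∂ν :=
    integral_congr_ae (by filter_upwards [hae] with c hc; exact hc.2.1)
  have h2 : ∫ c, orthSq Φ c ∂ν = ∫ c, fibreSq (boOrth Φ) c ∂ν :=
    integral_congr_ae (by filter_upwards [hae] with c hc; exact hc.2.2.symm)
  refine ⟨by rw [h1, hfo], by rw [h2, hfo], ?_⟩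
  obtain ⟨hs2, ho⟩ := integrable_orthSq hΦ
  rw [← hf, ← hfo, ← h2, ← integral_add hs2 ho]
  exact integral_congr_ae (ae_of_all _ fun c => by simp only [orthSq]; ring)

/-! ### §2 ★★ The three model blocks -/

section Blocks

variable {k : C → C → ℝ} {a b : σ → ℝ} {μ₁ ρ : ℝ}

/-- ★★ **STIFF block**: `T(Φ − PΦ, Φ − PΦ) ≤ λ₀ρμ₁·‖Φ − PΦ‖²`. [cite: Luscher1983, §3] -/
theorem tensorForm_boOrth_le (ha : ∀ i, 0 < a i) (hb : ∀ i, 0 < b i) (hab : ∀ i, a i ^ 2 + 2 * a i * b i = π ^ 2)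
    (hρ0 : 0 ≤ ρ) (hρ : ∀ i, b i / (a i + b i + π) ≤ ρ) (hρ1 : ρ ≤ 1)
    (hk0 : ∀ c c', 0 ≤ k c c') (hksymm : ∀ c c', k c c' = k c' c) (hkm : Measurable (Function.uncurry k))
    (hkint : ∀ c, Integrable (k c) ν) (hμ₁ : 0 ≤ μ₁) (hkrow : ∀ c, ∫ c', k c c' ∂ν ≤ μ₁) {Φ : C × (σ → ℝ) → ℝ} (hΦ : MemLp Φ 2 (ν.prod volume)) :
    tensorForm ν k a b (boOrth Φ) (boOrth Φ) ≤ (∏ i, Real.sqrt (π / (a i + b i + π))) * ρ * μ₁ * ∫ x, boOrth Φ x ^ 2 ∂(ν.prod volume) := by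
  have hO := memLp_boOrth hΦ
  have h := abs_tensorForm_sub_slow_le ha hb hab hρ0 hρ hρ1 hk0 hksymm hkm hkint hμ₁ hkrow hO hO
  -- the slow term vanishes: `slowCoeff (boOrth Φ) = 0` a.e.
  have hS : ∫ c, ∫ c', slowCoeff (boOrth Φ) c * k c c' * slowCoeff (boOrth Φ) c' ∂ν ∂ν = 0 := by
    refine integral_eq_zero_of_ae ?_
    filter_upwards [ae_slowCoeff_boOrth hΦ] with c hc
    simp [hc.1]
  rw [hS, mul_zero, sub_zero, (integral_sq_eq_slow_add_orth hΦ).1, Real.mul_self_sqrt (integral_nonneg fun x => sq_nonneg _)] at h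
  exact (abs_le.mp h).2

/-- ★★ **OFF-DIAGONAL block vanishes**: `T(PΦ, Ψ − PΨ) = 0`. [cite: Luscher1983, §3] -/
theorem tensorForm_boProj_boOrth (ha : ∀ i, 0 < a i) (hb : ∀ i, 0 < b i) (hab : ∀ i, a i ^ 2 + 2 * a i * b i = π ^ 2)
    (hk0 : ∀ c c', 0 ≤ k c c') (hksymm : ∀ c c', k c c' = k c' c) (hkm : Measurable (Function.uncurry k))
    (hkint : ∀ c, Integrable (k c) ν) (hμ₁ : 0 ≤ μ₁) (hkrow : ∀ c, ∫ c', k c c' ∂ν ≤ μ₁) {Φ Ψ : C × (σ → ℝ) → ℝ} (hΦ : MemLp Φ 2 (ν.prod volume))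
    (hΨ : MemLp Ψ 2 (ν.prod volume)) :
    tensorForm ν k a b (boProj Φ) (boOrth Ψ) = 0 := by
  have hs : ∀ i, 0 < a i + b i + π := fun i => by have := Real.pi_pos; linarith [ha i, hb i]
  have hr1 : ∀ i, b i / (a i + b i + π) ≤ 1 := fun i => by rw [div_le_one (hs i)]; have := Real.pi_pos; linarith [ha i]
  have h := abs_tensorForm_sub_slow_le ha hb hab zero_le_one hr1 le_rfl hk0 hksymm hkm hkint hμ₁ hkrow (memLp_boProj hΦ) (memLp_boOrth hΨ)
  -- slow term: `slowCoeff (boOrth Ψ) = 0` a.e. in `c'`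
  have hS : ∫ c, ∫ c', slowCoeff (boProj Φ) c * k c c' * slowCoeff (boOrth Ψ) c' ∂ν ∂ν = 0 := by
    refine integral_eq_zero_of_ae (Filter.Eventually.of_forall fun c => ?_)
    refine integral_eq_zero_of_ae ?_
    filter_upwards [ae_slowCoeff_boOrth hΨ] with c' hc'
    simp [hc'.1]
  -- remainder: `orthSq (boProj Φ) = 0`
  have hR : ∫ c, orthSq (boProj Φ) c ∂ν = 0 :=
    integral_eq_zero_of_ae (Filter.Eventually.of_forall fun c => (slowCoeff_boProj Φ c).2)
  simp only [hS, hR, Real.sqrt_zero, mul_zero, zero_mul, sub_zero] at h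
  exact abs_nonpos_iff.mp h

/-- ★★ **DIAGONAL block is the slow form**: `T(PΦ, PΨ) = λ₀ · ∫∫ φ₀(c) k(c,c') ψ₀(c')`. [cite: Luscher1983, §3] -/
theorem tensorForm_boProj_boProj (ha : ∀ i, 0 < a i) (hb : ∀ i, 0 < b i) (hab : ∀ i, a i ^ 2 + 2 * a i * b i = π ^ 2)
    (hk0 : ∀ c c', 0 ≤ k c c') (hksymm : ∀ c c', k c c' = k c' c) (hkm : Measurable (Function.uncurry k))
    (hkint : ∀ c, Integrable (k c) ν) (hμ₁ : 0 ≤ μ₁) (hkrow : ∀ c, ∫ c', k c c' ∂ν ≤ μ₁) {Φ Ψ : C × (σ → ℝ) → ℝ} (hΦ : MemLp Φ 2 (ν.prod volume))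
    (hΨ : MemLp Ψ 2 (ν.prod volume)) :
    tensorForm ν k a b (boProj Φ) (boProj Ψ) =
      (∏ i, Real.sqrt (π / (a i + b i + π))) * ∫ c, ∫ c', slowCoeff Φ c * k c c' * slowCoeff Ψ c' ∂ν ∂ν := by
  have hs : ∀ i, 0 < a i + b i + π := fun i => by have := Real.pi_pos; linarith [ha i, hb i]
  have hr1 : ∀ i, b i / (a i + b i + π) ≤ 1 := fun i => by rw [div_le_one (hs i)]; have := Real.pi_pos; linarith [ha i]
  have h := abs_tensorForm_sub_slow_le ha hb hab zero_le_one hr1 le_rfl hk0 hksymm hkm hkint hμ₁ hkrow (memLp_boProj hΦ) (memLp_boProj hΨ)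
  have hR : ∫ c, orthSq (boProj Φ) c ∂ν = 0 :=
    integral_eq_zero_of_ae (Filter.Eventually.of_forall fun c => (slowCoeff_boProj Φ c).2)
  have hcoef : ∀ (c : C), slowCoeff (boProj Φ) c = slowCoeff Φ c := fun c => (slowCoeff_boProj Φ c).1
  have hcoef' : ∀ (c : C), slowCoeff (boProj Ψ) c = slowCoeff Ψ c := fun c => (slowCoeff_boProj Ψ c).1
  simp_rw [hcoef, hcoef'] at h
  simp only [hR, Real.sqrt_zero, mul_zero, zero_mul] at h
  have := abs_nonpos_iff.mp h
  linarith [this]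

end Blocks

end

end Summit.QuantumFields.YangMills.Theorems.FemtoTransferGap.Mehler
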